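import Mathlib
import HarnessLib
import Summits.HubbardSuperconductivity.HubbardSuperconductivity.Theorems.KLProgrammeKLRegimeEngineTowerBlockZeroLev
import Summits.HubbardSuperconductivity.HubbardSuperconductivity.Theorems.KLProgrammeKLRegimeEngineTowerBlockIncrLevKitUnits

/-!
# Route `KLProgramme` — crux K3 ENGINE (stmt-HubbardSuperconductivity-20437 `KLRegimeEngineV17F2`), stub (b) v2, THE LEVELS PACKAGE (ℓ):
# instantiation (I1-dim), BLOCK `0` — the three block-`0` born arrays in the kit's literal shape and divided by ANY output unit `(u, Kc)`
# (continuation of `…TowerBlockZeroWt` / `…WtFull` / `…Lev` (p644020/p644860/p645178); cell gate-hubbard-kl, seat hubbard-kl-k3c2-p3 g12 as SUBSTITUTE typer while the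
#  E1 lineage is unseated — E1 / the kit-dictionary lane may rename or supersede)

Exactly the units step of `…TowerBlockIncrWtKitUnits` (k3c3-p2 g13) / `…TowerBlockIncrWtFullKit` / `…TowerBlockIncrLevKitUnits`, now for block `0`:

* **`klTowerBornWt_zero_le_kit_units`** — weighted pinned track: absolute input sizes `N m′ = ε^{2m′}·B m′` (`B` = weighted PLAIN pinned sums of `𝒱_0` in the trivial
  family) ARE `(ε·Kc)·(u^m·μ m)` with `μ m := ε^{2m}·B m/((ε·Kc)·u^m)`; conclusion `klTowerBornWt … d 0 (2(q+1)) ≤ (ε·cr)(ε·cc)^{2q+1}(u^{q+1}Kc)·[towerFO D (κ²u) μ (q+1) + Σ e·Φ̂^{n−1}ψ̂^{q+1}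
  towerS D (τu) μ n (q+1) + ψ̂^{q+1}·tail]`, `τ = (e²(κ+ρ))²`, `Φ̂ = (eα/κ²)·εKc`, `ψ̂ = ρ⁻²/u`;
* **`klTowerBornWtFull_zero_le_kit_units`**, **`klTowerBornLev_zero_le_kit_units`** — prescribed tracks: track-blind majorant in product form `N m = (ε·Kc)·(u^m·μ m)`,
  literal kit shape with `cr′ = e⁴cr/2`, `cc′ = e²cc` (`kitBrackets_explicitFO_le_literal`), then `kitStep_abs_eq_units_mul`.
Compositions of landed theorems and real algebra; nothing about the model is asserted beyond them; nothing asserts (ℓ), any stub, K3 or superconductivity.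
References: BGM 2006 §2.8 (2.83), §3 (3.2)–(3.8) [cite: BenfattoGiulianiMastropietro2006].
-/

noncomputable section

namespace Summit.HubbardSuperconductivity.HubbardSuperconductivity.Theorems.EngineV8

set_option linter.dupNamespace false -- summit = problem name (single-conjunct summit), D-0017

open Classical
open Real Finset Literature.MathematicalPhysics.QuantumLattice Literature.Probability.LatticeModels GrassmannAlgebra
open Literature.MathematicalPhysics.QuantumLattice.FermiRG
open Summit.HubbardSuperconductivity.HubbardSuperconductivity.Theorems.KLProgrammeLegKernels
open Summit.HubbardSuperconductivity.HubbardSuperconductivity.Theorems.KLRegimeSplit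
open Summit.HubbardSuperconductivity.HubbardSuperconductivity.Theorems.KLRegimeWick
open Summit.HubbardSuperconductivity.HubbardSuperconductivity.Theorems.TwoPointAssembly
open Summit.HubbardSuperconductivity.HubbardSuperconductivity.Theorems.DispersionFlow
open scoped Nat

variable {L M : ℕ} [NeZero L] [NeZero M]

/-! ## §1 Weighted pinned track, block `0` -/

/-- **BLOCK `0`'S BORN WEIGHTED ARRAY DIVIDED BY AN OUTPUT UNIT `(u, Kc)`** — binders of `klTowerBornWt_zero_le_kit` with the kit guard in dimensionless form;
`μ m := ε^{2m}·B m/((ε·Kc)·u^m)`. -/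
theorem klTowerBornWt_zero_le_kit_units {β : ℝ} (hβ : 0 < β) (U μ : ℝ) (K : TrigPolyC4v) (d : ℕ)
    (hZ : hubbardEffPartitionFnCT L M β U μ 0 K (klScale klE0 0) ≠ 0)
    {κ : ℝ} (hκ : 0 < κ)
    (hGB : IsGramBoundedR ((sectorSubMatrix L M β (trivialMultiplier L M)).transpose *
      hubbardCovSliceCT L M β μ 0 K (klScale klE0 d) (klScale klE0 0) * sectorSubMatrix L M β (trivialMultiplier L M)) κ)
    (B : ℕ → ℝ) (hB0 : ∀ m', 0 ≤ B m') (hB00 : B 0 = 0)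
    (hB : ∀ (m' : ℕ) (j : Fin (2 * m')) (w : SpaceTimeIdx L M × SectorLeg 1),
      ∑ Y ∈ univ.filter (fun Y : Fin (2 * m') → SpaceTimeIdx L M × SectorLeg 1 => Y j = w),
        klScaleWt L M β 0 ((univ.image Y).image (latticeLegPos (2 * (2 * M)))) *
          ‖kernel ℂ (ExteriorAlgebra.map (Matrix.toLin' (sectorAnalysisMatrix L M β (trivialMultiplier L M)))
            (klEffectiveAction L M β U μ K klE0 0)) (2 * m') Y‖ ≤ B m')
    {α : ℝ} (hα : 0 < α)
    (hrow : ∀ X, ∑ Y, ‖((sectorSubMatrix L M β (trivialMultiplier L M)).transpose *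
        hubbardCovSliceCT L M β μ 0 K (klScale klE0 d) (klScale klE0 0) * sectorSubMatrix L M β (trivialMultiplier L M)) X Y‖ *
        klScaleWt L M β 0 {latticeLegPos (2 * (2 * M)) X, latticeLegPos (2 * (2 * M)) Y} ≤ α)
    (hcol : ∀ Y, ∑ X, ‖((sectorSubMatrix L M β (trivialMultiplier L M)).transpose *
        hubbardCovSliceCT L M β μ 0 K (klScale klE0 d) (klScale klE0 0) * sectorSubMatrix L M β (trivialMultiplier L M)) X Y‖ *
        klScaleWt L M β 0 {latticeLegPos (2 * (2 * M)) X, latticeLegPos (2 * (2 * M)) Y} ≤ α)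
    {ρ : ℝ} (hρ : 0 < ρ)
    {cr cc : ℝ} (hcr0 : 0 ≤ cr) (hcc0 : 0 ≤ cc)
    (hrow' : ∀ X'', ∑ X', ‖(sectorAnalysisMatrix L M β (klAnisoFamily L M β μ K klE0 0) *
        sectorSubMatrix L M β (trivialMultiplier L M)) X'' X'‖ *
        klScaleWt L M β 0 {latticeLegPos (2 * (2 * M)) X'', latticeLegPos (2 * (2 * M)) X'} ≤ cr)
    (hcol' : ∀ X', ∑ X'', ‖(sectorAnalysisMatrix L M β (klAnisoFamily L M β μ K klE0 0) *
        sectorSubMatrix L M β (trivialMultiplier L M)) X'' X'‖ *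
        klScaleWt L M β 0 {latticeLegPos (2 * (2 * M)) X'', latticeLegPos (2 * (2 * M)) X'} ≤ cc)
    {N₀ : ℕ} (hN₀ : 2 ≤ N₀) {D : ℕ} (hD : Fintype.card (SpaceTimeIdx L M × SectorLeg 1) / 2 ≤ D)
    {u Kc : ℝ} (hu : 0 < u) (hKc : 0 < Kc)
    (hguard : Real.exp 1 * α / κ ^ 2 * (imagTimeWeight β M * Kc) *
      towerV D ((Real.exp 2 * (κ + ρ)) ^ 2 * u) (fun m => imagTimeWeight β M ^ (2 * m) * B m / ((imagTimeWeight β M * Kc) * u ^ m)) < 1)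
    (q : ℕ) :
    klTowerBornWt L M β U μ K d 0 (2 * (q + 1)) ≤
      (imagTimeWeight β M * cr) * (imagTimeWeight β M * cc) ^ (2 * q + 1) * (u ^ (q + 1) * Kc) *
        (towerFO D (κ ^ 2 * u) (fun m => imagTimeWeight β M ^ (2 * m) * B m / ((imagTimeWeight β M * Kc) * u ^ m)) (q + 1) +
          ∑ n ∈ Icc 2 (N₀ - 1), Real.exp 1 * (Real.exp 1 * α / κ ^ 2 * (imagTimeWeight β M * Kc)) ^ (n - 1) * (ρ⁻¹ ^ 2 / u) ^ (q + 1) *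
            towerS D ((Real.exp 2 * (κ + ρ)) ^ 2 * u) (fun m => imagTimeWeight β M ^ (2 * m) * B m / ((imagTimeWeight β M * Kc) * u ^ m)) n (q + 1) +
          (ρ⁻¹ ^ 2 / u) ^ (q + 1) * Real.exp 1 *
            towerV D ((Real.exp 2 * (κ + ρ)) ^ 2 * u) (fun m => imagTimeWeight β M ^ (2 * m) * B m / ((imagTimeWeight β M * Kc) * u ^ m)) *
            (Real.exp 1 * α / κ ^ 2 * (imagTimeWeight β M * Kc) *
              towerV D ((Real.exp 2 * (κ + ρ)) ^ 2 * u) (fun m => imagTimeWeight β M ^ (2 * m) * B m / ((imagTimeWeight β M * Kc) * u ^ m))) ^ (N₀ - 1) /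
            (1 - Real.exp 1 * α / κ ^ 2 * (imagTimeWeight β M * Kc) *
              towerV D ((Real.exp 2 * (κ + ρ)) ^ 2 * u) (fun m => imagTimeWeight β M ^ (2 * m) * B m / ((imagTimeWeight β M * Kc) * u ^ m)))) := by
  have hε : 0 < imagTimeWeight β M := imagTimeWeight_pos_of_pos (M := M) hβ
  set μd : ℕ → ℝ := fun m => imagTimeWeight β M ^ (2 * m) * B m / ((imagTimeWeight β M * Kc) * u ^ m) with hμd
  -- the absolute sizes in product form
  have hN : (fun m' : ℕ => imagTimeWeight β M ^ (2 * m') * B m') = fun m' => (imagTimeWeight β M * Kc) * (u ^ m' * μd m') := by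
    funext m'
    have : u ^ m' ≠ 0 := pow_ne_zero _ hu.ne'
    rw [hμd]; field_simp
  have hV : towerV D ((Real.exp 2 * (κ + ρ)) ^ 2) (fun m' => imagTimeWeight β M ^ (2 * m') * B m') =
      (imagTimeWeight β M * Kc) * towerV D ((Real.exp 2 * (κ + ρ)) ^ 2 * u) μd := by
    rw [hN]; exact towerV_units D _ _ u μd
  have hguard' : Real.exp 1 * α / κ ^ 2 * towerV D ((Real.exp 2 * (κ + ρ)) ^ 2) (fun m' => imagTimeWeight β M ^ (2 * m') * B m') < 1 := by
    rw [hV, ← mul_assoc]; exact hguard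
  have h := klTowerBornWt_zero_le_kit (L := L) (M := M) hβ U μ K d hZ hκ hGB B hB0 hB00 hB hα hrow hcol hρ hcr0 hcc0 hrow' hcol' hN₀ hD hguard' q
  rw [hN] at h
  rw [kitStep_abs_eq_units_mul (mul_ne_zero hε.ne' hKc.ne') hu.ne'] at h
  refine h.trans (le_of_eq ?_)
  ring

/-! ## §2 Weighted all-known track, block `0` -/

/-- **BLOCK `0`'S WEIGHTED ALL-KNOWN BORN ARRAY DIVIDED BY AN OUTPUT UNIT `(u, Kc)`** — binders of `klTowerBornWtFull_zero_le_kit` with the track-blind majorant in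
product form `N m = (ε·Kc)·(u^m·μ m)` (dimensionless `μ ≥ 0`, `μ 0 = 0`) and the kit guard in dimensionless form; literal kit shape `cr′ = e⁴cr/2`, `cc′ = e²cc`. -/
theorem klTowerBornWtFull_zero_le_kit_units {β : ℝ} (hβ : 0 < β) (U μ : ℝ) (K : TrigPolyC4v) (d : ℕ)
    (hZ : hubbardEffPartitionFnCT L M β U μ 0 K (klScale klE0 0) ≠ 0)
    {κ : ℝ} (hκ : 0 < κ)
    (hGB : IsGramBoundedR ((sectorSubMatrix L M β (trivialMultiplier L M)).transpose *
      hubbardCovSliceCT L M β μ 0 K (klScale klE0 d) (klScale klE0 0) * sectorSubMatrix L M β (trivialMultiplier L M)) κ)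
    (B : ℕ → ℕ → ℝ) (hB0 : ∀ m' Fc, 0 ≤ B m' Fc)
    (hB : ∀ (m' Fc : ℕ) (E : Finset (Fin (2 * m' + 1 + 1))) (τ' : Fin (2 * m' + 1 + 1) → SectorLeg 1)
      (q : Fin (2 * m' + 1 + 1)), q ∈ E → E.card = Fc + 1 → ∀ y : SpaceTimeIdx L M,
        imagTimeWeight β M ^ (2 * m' + 1) *
          ∑ σ ∈ univ.filter (fun σ : Fin (2 * m' + 1 + 1) → SectorLeg 1 => ∀ e ∈ E, σ e = τ' e),
            ∑ x ∈ univ.filter (fun x : Fin (2 * m' + 1 + 1) → SpaceTimeIdx L M => x q = y),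
              klScaleWt L M β 0 ((univ.image fun i => (x i, σ i)).image (latticeLegPos (2 * (2 * M)))) *
                ‖sectorisedKernel L M β (trivialMultiplier L M) (klEffectiveAction L M β U μ K klE0 0) (2 * m' + 1 + 1) σ x‖ ≤ B (m' + 1) Fc)
    {α : ℝ} (hα : 0 < α)
    (hrow : ∀ X, ∑ Y, ‖((sectorSubMatrix L M β (trivialMultiplier L M)).transpose *
        hubbardCovSliceCT L M β μ 0 K (klScale klE0 d) (klScale klE0 0) * sectorSubMatrix L M β (trivialMultiplier L M)) X Y‖ *
        klScaleWt L M β 0 {latticeLegPos (2 * (2 * M)) X, latticeLegPos (2 * (2 * M)) Y} ≤ α)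
    (hcol : ∀ Y, ∑ X, ‖((sectorSubMatrix L M β (trivialMultiplier L M)).transpose *
        hubbardCovSliceCT L M β μ 0 K (klScale klE0 d) (klScale klE0 0) * sectorSubMatrix L M β (trivialMultiplier L M)) X Y‖ *
        klScaleWt L M β 0 {latticeLegPos (2 * (2 * M)) X, latticeLegPos (2 * (2 * M)) Y} ≤ α)
    {ρ : ℝ} (hρ : 0 < ρ)
    {cr cc : ℝ} (hcr0 : 0 ≤ cr) (hcc0 : 0 ≤ cc)
    (hrow' : ∀ X'', ∑ X', ‖(sectorAnalysisMatrix L M β (klAnisoFamily L M β μ K klE0 0) *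
        sectorSubMatrix L M β (trivialMultiplier L M)) X'' X'‖ *
        klScaleWt L M β 0 {latticeLegPos (2 * (2 * M)) X'', latticeLegPos (2 * (2 * M)) X'} ≤ cr)
    (hcol' : ∀ X', ∑ X'', ‖(sectorAnalysisMatrix L M β (klAnisoFamily L M β μ K klE0 0) *
        sectorSubMatrix L M β (trivialMultiplier L M)) X'' X'‖ *
        klScaleWt L M β 0 {latticeLegPos (2 * (2 * M)) X'', latticeLegPos (2 * (2 * M)) X'} ≤ cc)
    {N₀ : ℕ} (hN₀ : 2 ≤ N₀)
    {u Kc : ℝ} (hu : 0 < u) (hKc : 0 < Kc) {μd : ℕ → ℝ} (hμ0 : ∀ m, 0 ≤ μd m) (hμ00 : μd 0 = 0)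
    (hNB : ∀ m c, (1 : ℝ) ^ c * (imagTimeWeight β M * B m c) ≤ (imagTimeWeight β M * Kc) * (u ^ m * μd m))
    {D : ℕ} (hD : Fintype.card (SpaceTimeIdx L M × SectorLeg 1) / 2 ≤ D)
    {τ ψ : ℝ} (hτ1 : (exp 3 * κ) ^ 2 ≤ τ) (hτ2 : (exp 2 * (κ + ρ)) ^ 2 ≤ τ) (hψ1 : κ⁻¹ ^ 2 ≤ ψ) (hψ2 : ρ⁻¹ ^ 2 ≤ ψ)
    (hguard : exp 1 * α / κ ^ 2 * (imagTimeWeight β M * Kc) * towerV D (τ * u) μd < 1) (q : ℕ) :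
    klTowerBornWtFull L M β U μ K d 0 (2 * (q + 1)) ≤
      (imagTimeWeight β M * (exp 4 / 2 * cr)) * (imagTimeWeight β M * (exp 2 * cc)) ^ (2 * q + 1) * (u ^ (q + 1) * Kc) *
        (towerFO D (κ ^ 2 * u) μd (q + 1) +
          ∑ n ∈ Icc 2 (N₀ - 1), exp 1 * (exp 1 * α / κ ^ 2 * (imagTimeWeight β M * Kc)) ^ (n - 1) * (ψ / u) ^ (q + 1) * towerS D (τ * u) μd n (q + 1) +
          (ψ / u) ^ (q + 1) * exp 1 * towerV D (τ * u) μd * (exp 1 * α / κ ^ 2 * (imagTimeWeight β M * Kc) * towerV D (τ * u) μd) ^ (N₀ - 1) /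
            (1 - exp 1 * α / κ ^ 2 * (imagTimeWeight β M * Kc) * towerV D (τ * u) μd)) := by
  have hε0 : 0 ≤ imagTimeWeight β M := imagTimeWeight_nonneg hβ.le M
  have hε : 0 < imagTimeWeight β M := imagTimeWeight_pos_of_pos (M := M) hβ
  have hN0 : ∀ m, 0 ≤ (imagTimeWeight β M * Kc) * (u ^ m * μd m) := fun m => by have := hμ0 m; positivity
  have hN00 : (imagTimeWeight β M * Kc) * (u ^ 0 * μd 0) = 0 := by rw [hμ00]; ring
  have hV : towerV D τ (fun m => (imagTimeWeight β M * Kc) * (u ^ m * μd m)) = (imagTimeWeight β M * Kc) * towerV D (τ * u) μd :=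
    towerV_units D τ _ u μd
  have hguard' : exp 1 * α / κ ^ 2 * towerV D τ (fun m => (imagTimeWeight β M * Kc) * (u ^ m * μd m)) < 1 := by
    rw [hV, ← mul_assoc]; exact hguard
  have h := klTowerBornWtFull_zero_le_kit (L := L) (M := M) hβ U μ K d hZ hκ hGB B hB0 hB hα hrow hcol hρ hcr0 hcc0 hrow' hcol' hN₀
    (N := fun m => (imagTimeWeight β M * Kc) * (u ^ m * μd m)) hN0 hN00 hNB hD hτ1 hτ2 hψ1 hψ2 hguard' q
  -- literal kit shape
  have hτ0 : 0 ≤ τ := le_trans (by positivity) hτ1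
  have hψ0 : 0 ≤ ψ := le_trans (by positivity) hψ1
  have hFO0 : 0 ≤ towerFO D (κ ^ 2) (fun m => (imagTimeWeight β M * Kc) * (u ^ m * μd m)) (q + 1) := towerFO_nonneg (by positivity) hN0 _
  have hS0 : 0 ≤ ∑ n ∈ Icc 2 (N₀ - 1), exp 1 * (exp 1 * α / κ ^ 2) ^ (n - 1) * ψ ^ (q + 1) *
      towerS D τ (fun m => (imagTimeWeight β M * Kc) * (u ^ m * μd m)) n (q + 1) :=
    sum_nonneg fun n _ => by have := towerS_nonneg (D := D) hτ0 hN0 n (q + 1); positivity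
  have hT0 : 0 ≤ ψ ^ (q + 1) * (exp 1 * towerV D τ (fun m => (imagTimeWeight β M * Kc) * (u ^ m * μd m)) *
      (exp 1 * α / κ ^ 2 * towerV D τ (fun m => (imagTimeWeight β M * Kc) * (u ^ m * μd m))) ^ (N₀ - 1) /
      (1 - exp 1 * α / κ ^ 2 * towerV D τ (fun m => (imagTimeWeight β M * Kc) * (u ^ m * μd m)))) := by
    have hV0 := towerV_nonneg (D := D) hτ0 hN0
    exact mul_nonneg (pow_nonneg hψ0 _) (div_nonneg (by positivity) (sub_nonneg.2 hguard'.le))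
  have h' := h.trans (mul_le_mul_of_nonneg_left (kitBrackets_explicitFO_le_literal hcr0 hcc0 hFO0 hS0 hT0 q) (pow_nonneg hε0 _))
  have hk := kitStep_abs_eq_units_mul (K := imagTimeWeight β M * Kc) (u := u) (mul_ne_zero hε.ne' hKc.ne') hu.ne' D (κ ^ 2) τ
    (exp 1 * α / κ ^ 2) ψ μd (N₀ - 1) (q + 1)
  refine h'.trans (le_of_eq ?_)
  rw [show ψ ^ (q + 1) * (exp 1 * towerV D τ (fun m => imagTimeWeight β M * Kc * (u ^ m * μd m)) *
        (exp 1 * α / κ ^ 2 * towerV D τ (fun m => imagTimeWeight β M * Kc * (u ^ m * μd m))) ^ (N₀ - 1) /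
        (1 - exp 1 * α / κ ^ 2 * towerV D τ (fun m => imagTimeWeight β M * Kc * (u ^ m * μd m)))) =
      ψ ^ (q + 1) * exp 1 * towerV D τ (fun m => imagTimeWeight β M * Kc * (u ^ m * μd m)) *
        (exp 1 * α / κ ^ 2 * towerV D τ (fun m => imagTimeWeight β M * Kc * (u ^ m * μd m))) ^ (N₀ - 1) /
        (1 - exp 1 * α / κ ^ 2 * towerV D τ (fun m => imagTimeWeight β M * Kc * (u ^ m * μd m))) by ring, hk]
  ring

/-! ## §3 Levelled tracks, block `0` -/

/-- **BLOCK `0`'S BORN LEVELLED ARRAYS DIVIDED BY AN OUTPUT UNIT `(u, Kc)`**, every level count `F` — binders of `klTowerBornLev_zero_le_kit` with the majorant in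
product form and the kit guard in dimensionless form; literal kit shape `cr′ = e⁴cr/2`, `cc′ = e²cc`. -/
theorem klTowerBornLev_zero_le_kit_units {β : ℝ} (hβ : 0 < β) (U μ : ℝ) (K : TrigPolyC4v) (d : ℕ)
    (hZ : hubbardEffPartitionFnCT L M β U μ 0 K (klScale klE0 0) ≠ 0)
    {κ : ℝ} (hκ : 0 < κ)
    (hGB : IsGramBoundedR ((sectorSubMatrix L M β (trivialMultiplier L M)).transpose *
      hubbardCovSliceCT L M β μ 0 K (klScale klE0 d) (klScale klE0 0) * sectorSubMatrix L M β (trivialMultiplier L M)) κ)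
    (B : ℕ → ℕ → ℝ) (hB0 : ∀ m' Fc, 0 ≤ B m' Fc)
    (hB : ∀ (m' Fc : ℕ) (E : Finset (Fin (2 * m' + 1 + 1))) (τ' : Fin (2 * m' + 1 + 1) → SectorLeg 1)
      (q : Fin (2 * m' + 1 + 1)), q ∈ E → E.card = Fc + 1 → ∀ y : SpaceTimeIdx L M,
        imagTimeWeight β M ^ (2 * m' + 1) *
          ∑ σ ∈ univ.filter (fun σ : Fin (2 * m' + 1 + 1) → SectorLeg 1 => ∀ e ∈ E, σ e = τ' e),
            ∑ x ∈ univ.filter (fun x : Fin (2 * m' + 1 + 1) → SpaceTimeIdx L M => x q = y),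
              ‖sectorisedKernel L M β (trivialMultiplier L M) (klEffectiveAction L M β U μ K klE0 0) (2 * m' + 1 + 1) σ x‖ ≤ B (m' + 1) Fc)
    {α : ℝ} (hα : 0 < α)
    (hrow : ∀ X, ∑ Y, ‖((sectorSubMatrix L M β (trivialMultiplier L M)).transpose *
        hubbardCovSliceCT L M β μ 0 K (klScale klE0 d) (klScale klE0 0) * sectorSubMatrix L M β (trivialMultiplier L M)) X Y‖ ≤ α)
    (hcol : ∀ Y, ∑ X, ‖((sectorSubMatrix L M β (trivialMultiplier L M)).transpose *
        hubbardCovSliceCT L M β μ 0 K (klScale klE0 d) (klScale klE0 0) * sectorSubMatrix L M β (trivialMultiplier L M)) X Y‖ ≤ α)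
    {ρ : ℝ} (hρ : 0 < ρ)
    {cr cc : ℝ} (hcr0 : 0 ≤ cr) (hcc0 : 0 ≤ cc)
    (hrow' : ∀ X'', ∑ X', ‖(sectorAnalysisMatrix L M β (klAnisoFamily L M β μ K klE0 0) * sectorSubMatrix L M β (trivialMultiplier L M)) X'' X'‖ ≤ cr)
    (hcol' : ∀ X', ∑ X'', ‖(sectorAnalysisMatrix L M β (klAnisoFamily L M β μ K klE0 0) * sectorSubMatrix L M β (trivialMultiplier L M)) X'' X'‖ ≤ cc)
    {N₀ : ℕ} (hN₀ : 2 ≤ N₀)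
    {u Kc : ℝ} (hu : 0 < u) (hKc : 0 < Kc) {μd : ℕ → ℝ} (hμ0 : ∀ m, 0 ≤ μd m) (hμ00 : μd 0 = 0)
    (hNB : ∀ m c, (1 : ℝ) ^ c * (imagTimeWeight β M * B m c) ≤ (imagTimeWeight β M * Kc) * (u ^ m * μd m))
    {D : ℕ} (hD : Fintype.card (SpaceTimeIdx L M × SectorLeg 1) / 2 ≤ D)
    {τ ψ : ℝ} (hτ1 : (exp 3 * κ) ^ 2 ≤ τ) (hτ2 : (exp 2 * (κ + ρ)) ^ 2 ≤ τ) (hψ1 : κ⁻¹ ^ 2 ≤ ψ) (hψ2 : ρ⁻¹ ^ 2 ≤ ψ)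
    (hguard : exp 1 * α / κ ^ 2 * (imagTimeWeight β M * Kc) * towerV D (τ * u) μd < 1) (q F : ℕ) :
    klTowerBornLev L M β U μ K d 0 (2 * (q + 1)) F ≤
      (imagTimeWeight β M * (exp 4 / 2 * cr)) * (imagTimeWeight β M * (exp 2 * cc)) ^ (2 * q + 1) * (u ^ (q + 1) * Kc) *
        (towerFO D (κ ^ 2 * u) μd (q + 1) +
          ∑ n ∈ Icc 2 (N₀ - 1), exp 1 * (exp 1 * α / κ ^ 2 * (imagTimeWeight β M * Kc)) ^ (n - 1) * (ψ / u) ^ (q + 1) * towerS D (τ * u) μd n (q + 1) +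
          (ψ / u) ^ (q + 1) * exp 1 * towerV D (τ * u) μd * (exp 1 * α / κ ^ 2 * (imagTimeWeight β M * Kc) * towerV D (τ * u) μd) ^ (N₀ - 1) /
            (1 - exp 1 * α / κ ^ 2 * (imagTimeWeight β M * Kc) * towerV D (τ * u) μd)) := by
  have hε0 : 0 ≤ imagTimeWeight β M := imagTimeWeight_nonneg hβ.le M
  have hε : 0 < imagTimeWeight β M := imagTimeWeight_pos_of_pos (M := M) hβ
  have hN0 : ∀ m, 0 ≤ (imagTimeWeight β M * Kc) * (u ^ m * μd m) := fun m => by have := hμ0 m; positivity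
  have hN00 : (imagTimeWeight β M * Kc) * (u ^ 0 * μd 0) = 0 := by rw [hμ00]; ring
  have hV : towerV D τ (fun m => (imagTimeWeight β M * Kc) * (u ^ m * μd m)) = (imagTimeWeight β M * Kc) * towerV D (τ * u) μd :=
    towerV_units D τ _ u μd
  have hguard' : exp 1 * α / κ ^ 2 * towerV D τ (fun m => (imagTimeWeight β M * Kc) * (u ^ m * μd m)) < 1 := by
    rw [hV, ← mul_assoc]; exact hguard
  have h := klTowerBornLev_zero_le_kit (L := L) (M := M) hβ U μ K d hZ hκ hGB B hB0 hB hα hrow hcol hρ hcr0 hcc0 hrow' hcol' hN₀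
    (N := fun m => (imagTimeWeight β M * Kc) * (u ^ m * μd m)) hN0 hN00 hNB hD hτ1 hτ2 hψ1 hψ2 hguard' q F
  have hτ0 : 0 ≤ τ := le_trans (by positivity) hτ1
  have hψ0 : 0 ≤ ψ := le_trans (by positivity) hψ1
  have hFO0 : 0 ≤ towerFO D (κ ^ 2) (fun m => (imagTimeWeight β M * Kc) * (u ^ m * μd m)) (q + 1) := towerFO_nonneg (by positivity) hN0 _
  have hS0 : 0 ≤ ∑ n ∈ Icc 2 (N₀ - 1), exp 1 * (exp 1 * α / κ ^ 2) ^ (n - 1) * ψ ^ (q + 1) *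
      towerS D τ (fun m => (imagTimeWeight β M * Kc) * (u ^ m * μd m)) n (q + 1) :=
    sum_nonneg fun n _ => by have := towerS_nonneg (D := D) hτ0 hN0 n (q + 1); positivity
  have hT0 : 0 ≤ ψ ^ (q + 1) * (exp 1 * towerV D τ (fun m => (imagTimeWeight β M * Kc) * (u ^ m * μd m)) *
      (exp 1 * α / κ ^ 2 * towerV D τ (fun m => (imagTimeWeight β M * Kc) * (u ^ m * μd m))) ^ (N₀ - 1) /
      (1 - exp 1 * α / κ ^ 2 * towerV D τ (fun m => (imagTimeWeight β M * Kc) * (u ^ m * μd m)))) := by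
    have hV0 := towerV_nonneg (D := D) hτ0 hN0
    exact mul_nonneg (pow_nonneg hψ0 _) (div_nonneg (by positivity) (sub_nonneg.2 hguard'.le))
  have h' := h.trans (mul_le_mul_of_nonneg_left (kitBrackets_explicitFO_le_literal hcr0 hcc0 hFO0 hS0 hT0 q) (pow_nonneg hε0 _))
  have hk := kitStep_abs_eq_units_mul (K := imagTimeWeight β M * Kc) (u := u) (mul_ne_zero hε.ne' hKc.ne') hu.ne' D (κ ^ 2) τ
    (exp 1 * α / κ ^ 2) ψ μd (N₀ - 1) (q + 1)
  refine h'.trans (le_of_eq ?_)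
  rw [show ψ ^ (q + 1) * (exp 1 * towerV D τ (fun m => imagTimeWeight β M * Kc * (u ^ m * μd m)) *
        (exp 1 * α / κ ^ 2 * towerV D τ (fun m => imagTimeWeight β M * Kc * (u ^ m * μd m))) ^ (N₀ - 1) /
        (1 - exp 1 * α / κ ^ 2 * towerV D τ (fun m => imagTimeWeight β M * Kc * (u ^ m * μd m)))) =
      ψ ^ (q + 1) * exp 1 * towerV D τ (fun m => imagTimeWeight β M * Kc * (u ^ m * μd m)) *
        (exp 1 * α / κ ^ 2 * towerV D τ (fun m => imagTimeWeight β M * Kc * (u ^ m * μd m))) ^ (N₀ - 1) /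
        (1 - exp 1 * α / κ ^ 2 * towerV D τ (fun m => imagTimeWeight β M * Kc * (u ^ m * μd m))) by ring, hk]
  ring

end Summit.HubbardSuperconductivity.HubbardSuperconductivity.Theorems.EngineV8

end
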